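import Mathlib
import HarnessLib

/-!
# Trilinear forms with Kloosterman fractions: counting lemmas for the diagonal (Bettin–Chandee §3, (3.4))

Topic `NumberTheory/LFunctions`.  S. Bettin, V. Chandee, *Trilinear forms with Kloosterman
fractions*, Adv. Math. 328 (2018), §3: the bound (3.5) for the diagonal terms `𝒟_b` rests on
"the inequality `2|ab| ≤ a² + b²`" and symmetry (first display of §3), and on the gcd sum (3.4),
"`∑_{ℓ₁,ℓ₂,a₂ : a₁ℓ₁ ≠ a₂ℓ₂, ℓ₂ ∣ ℓ₁n₁} (a₁ℓ₁ − a₂ℓ₂, bn) ≪ ∑_{|c| ≤ 4AL, c ≠ 0} (c, bn) ⋯ ≪ AL²M^ε`".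
This file PROVES the elementary counting lemmas behind these steps, in generic form (for the
general-`A`, twisted diagonal of `TrilinearKloostermanFractionsFrom51.lean`, hypothesis `hD`):

* `BC_symmetrize_le` — `∑_{i,j} w(i,j) x_i x_j ≤ ∑_{i,j} w(i,j) x_i²` for symmetric `w ≥ 0`, `x ≥ 0`;
* `BC_sum_gcd_Icc_le` — `∑_{1 ≤ x ≤ N} (x, Q) ≤ τ(Q) N`; `BC_sum_gcd_image_le` — hence
  `∑_{a ∈ S} (f(a), Q) ≤ 2 τ(Q) N` for `f` injective on `S` with values in `[−N, N] ∖ {0}` (the map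
  `a₂ ↦ a₁ℓ₁ − a₂ℓ₂` of (3.4));
* `BC_card_filter_dvd_le_card_divisors` — `#{ℓ ∈ S : ℓ ∣ w} ≤ τ(w)` (`w ≠ 0`; the condition
  `ℓ₂ ∣ ℓ₁n₁`);
* `BC_sum_eq_mul_single_le` — `∑_{n ∈ T} [ℓ n = w] f(n) ≤ f(w/ℓ)` for `f ≥ 0` (`n₂` is determined by
  `ℓ₂n₂ = ℓ₁n₁`).

No new named facts (D-0026).

## References

* S. Bettin, V. Chandee, Adv. Math. 328 (2018) 1234–1262 (arXiv:1502.00769), §3 ((3.3)–(3.5)).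
  [BettinChandee2018]
-/

noncomputable section

open Finset

namespace Literature.NumberTheory.LFunctions

/-- **Symmetrization** ("by symmetry and the inequality `2|ab| ≤ a² + b²`", Bettin–Chandee §3):
for a finite index set `I`, symmetric weights `w(i,j) = w(j,i) ≥ 0` and `x ≥ 0`,
`∑_{i∈I}∑_{j∈I} w(i,j) x_i x_j ≤ ∑_{i∈I}∑_{j∈I} w(i,j) x_i²`. [cite: BettinChandee2018, §3] -/
theorem BC_symmetrize_le {ι : Type*} (I : Finset ι) (w : ι → ι → ℝ) (x : ι → ℝ)
    (hw : ∀ i ∈ I, ∀ j ∈ I, w i j = w j i) (hw0 : ∀ i ∈ I, ∀ j ∈ I, 0 ≤ w i j) :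
    ∑ i ∈ I, ∑ j ∈ I, w i j * (x i * x j) ≤ ∑ i ∈ I, ∑ j ∈ I, w i j * x i ^ 2 := by
  have hsymm : ∑ i ∈ I, ∑ j ∈ I, w i j * x j ^ 2 = ∑ i ∈ I, ∑ j ∈ I, w i j * x i ^ 2 := by
    rw [Finset.sum_comm]
    exact Finset.sum_congr rfl fun i hi => Finset.sum_congr rfl fun j hj => by rw [hw j hj i hi]
  have hle : ∑ i ∈ I, ∑ j ∈ I, w i j * (x i * x j) ≤
      ∑ i ∈ I, ∑ j ∈ I, (w i j * x i ^ 2 / 2 + w i j * x j ^ 2 / 2) := by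
    refine Finset.sum_le_sum fun i hi => Finset.sum_le_sum fun j hj => ?_
    have h2 : x i * x j ≤ x i ^ 2 / 2 + x j ^ 2 / 2 := by nlinarith [sq_nonneg (x i - x j)]
    have := mul_le_mul_of_nonneg_left h2 (hw0 i hi j hj)
    linarith
  refine hle.trans (le_of_eq ?_)
  simp only [Finset.sum_add_distrib, ← Finset.sum_div]
  rw [hsymm]
  ring

/-- **`∑_{1 ≤ x ≤ N} (x, Q) ≤ τ(Q) N`** (`(x,Q) = ∑_{d ∣ (x,Q)} φ(d)`, exchange, `φ(d) ⌊N/d⌋ ≤ N`).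
[folklore] -/
theorem BC_sum_gcd_Icc_le {Q : ℕ} (hQ : 0 < Q) (N : ℕ) :
    ∑ x ∈ Icc 1 N, (Nat.gcd x Q : ℝ) ≤ (Nat.divisors Q).card * N := by
  classical
  have hgcd : ∀ x : ℕ, (Nat.gcd x Q : ℝ) = ∑ d ∈ Nat.divisors Q, if d ∣ x then (Nat.totient d : ℝ) else 0 := by
    intro x
    have h1 : (Nat.gcd x Q : ℝ) = ∑ d ∈ (Nat.gcd x Q).divisors, (Nat.totient d : ℝ) := by
      exact_mod_cast (Nat.sum_totient (Nat.gcd x Q)).symm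
    rw [h1, ← Finset.sum_filter]
    refine Finset.sum_congr ?_ fun _ _ => rfl
    ext d
    simp only [Nat.mem_divisors, Finset.mem_filter, ne_eq]
    constructor
    · rintro ⟨hd, hne⟩
      exact ⟨⟨hd.trans (Nat.gcd_dvd_right _ _), hQ.ne'⟩, hd.trans (Nat.gcd_dvd_left _ _)⟩
    · rintro ⟨⟨hdQ, _⟩, hdx⟩
      exact ⟨Nat.dvd_gcd hdx hdQ, Nat.gcd_ne_zero_right hQ.ne'⟩
  simp_rw [hgcd]
  rw [Finset.sum_comm]
  have hinner : ∀ d ∈ Nat.divisors Q,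
      ∑ x ∈ Icc 1 N, (if d ∣ x then (Nat.totient d : ℝ) else 0) ≤ N := by
    intro d hd
    have hd0 : 0 < d := Nat.pos_of_mem_divisors hd
    rw [← Finset.sum_filter]
    simp only [Finset.sum_const, nsmul_eq_mul]
    have hcard : ((Icc 1 N).filter (fun x => d ∣ x)).card ≤ N / d := by
      have hI : Icc 1 N = Ioc 0 N := by
        ext x; simp only [Finset.mem_Icc, Finset.mem_Ioc]; omega
      rw [hI, Nat.Ioc_filter_dvd_card_eq_div N d]
    have htot : (Nat.totient d : ℝ) ≤ d := by exact_mod_cast Nat.totient_le d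
    calc ((((Icc 1 N).filter (fun x => d ∣ x)).card : ℕ) : ℝ) * (Nat.totient d : ℝ)
        ≤ ((N / d : ℕ) : ℝ) * d := by
          have h1 : ((((Icc 1 N).filter (fun x => d ∣ x)).card : ℕ) : ℝ) ≤ ((N / d : ℕ) : ℝ) := by
            exact_mod_cast hcard
          exact mul_le_mul h1 htot (Nat.cast_nonneg _) (Nat.cast_nonneg _)
      _ ≤ N := by
          have : ((N / d : ℕ) : ℝ) * d ≤ N := by exact_mod_cast Nat.div_mul_le_self N d
          exact this
  calc ∑ d ∈ Nat.divisors Q, ∑ x ∈ Icc 1 N, (if d ∣ x then (Nat.totient d : ℝ) else 0)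
      ≤ ∑ d ∈ Nat.divisors Q, (N : ℝ) := Finset.sum_le_sum hinner
    _ = (Nat.divisors Q).card * N := by rw [Finset.sum_const, nsmul_eq_mul]

/-- **The gcd sum over the values of an injective map** ((3.4): `a₂ ↦ c = a₁ℓ₁ − a₂ℓ₂`, distinct
nonzero integers of size `≤ 4AL`): if `f` is injective on `S` with values in `[−N, N] ∖ {0}`, then
`∑_{a∈S} (f(a), Q) ≤ 2 τ(Q) N`. [cite: BettinChandee2018, §3 (3.4)] -/
theorem BC_sum_gcd_image_le {Q : ℕ} (hQ : 0 < Q) (N : ℕ) (S : Finset ℕ) (f : ℕ → ℤ)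
    (hinj : Set.InjOn f S) (hval : ∀ a ∈ S, f a ≠ 0 ∧ |f a| ≤ N) :
    ∑ a ∈ S, (Int.gcd (f a) Q : ℝ) ≤ 2 * (Nat.divisors Q).card * N := by
  classical
  -- split according to the sign of `f a` and inject `|f a|` into `[1, N]`
  have hpos : ∑ a ∈ S.filter (fun a => 0 < f a), (Int.gcd (f a) Q : ℝ) ≤ (Nat.divisors Q).card * N := by
    have hinj' : Set.InjOn (fun a => (f a).toNat) (S.filter (fun a => 0 < f a) : Set ℕ) := by
      intro a ha a' ha' h
      simp only [Finset.coe_filter, Set.mem_setOf_eq] at ha ha'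
      have : f a = f a' := by
        have e1 : ((f a).toNat : ℤ) = f a := Int.toNat_of_nonneg ha.2.le
        have e2 : ((f a').toNat : ℤ) = f a' := Int.toNat_of_nonneg ha'.2.le
        rw [← e1, ← e2]; exact_mod_cast h
      exact hinj ha.1 ha'.1 this
    calc ∑ a ∈ S.filter (fun a => 0 < f a), (Int.gcd (f a) Q : ℝ)
        = ∑ a ∈ S.filter (fun a => 0 < f a), (Nat.gcd (f a).toNat Q : ℝ) := by
          refine Finset.sum_congr rfl fun a ha => ?_
          have ha' := (Finset.mem_filter.mp ha).2
          rw [Int.gcd_eq_natAbs, Int.natAbs_natCast]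
          congr 2
          have : ((f a).toNat : ℤ) = f a := Int.toNat_of_nonneg ha'.le
          omega
      _ = ∑ x ∈ (S.filter (fun a => 0 < f a)).image (fun a => (f a).toNat), (Nat.gcd x Q : ℝ) :=
          (Finset.sum_image (f := fun x => (Nat.gcd x Q : ℝ)) hinj').symm
      _ ≤ ∑ x ∈ Icc 1 N, (Nat.gcd x Q : ℝ) := by
          refine Finset.sum_le_sum_of_subset_of_nonneg ?_ fun _ _ _ => Nat.cast_nonneg _
          intro x hx
          obtain ⟨a, ha, rfl⟩ := Finset.mem_image.mp hx
          have ha' := Finset.mem_filter.mp ha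
          obtain ⟨hne, hle⟩ := hval a ha'.1
          rw [Finset.mem_Icc]
          constructor
          · have : 0 < (f a).toNat := by omega
            exact this
          · have : ((f a).toNat : ℤ) ≤ N := by
              rw [Int.toNat_of_nonneg ha'.2.le]; exact (le_abs_self _).trans hle
            exact_mod_cast this
      _ ≤ _ := BC_sum_gcd_Icc_le hQ N
  have hneg : ∑ a ∈ S.filter (fun a => f a < 0), (Int.gcd (f a) Q : ℝ) ≤ (Nat.divisors Q).card * N := by
    have hinj' : Set.InjOn (fun a => (-f a).toNat) (S.filter (fun a => f a < 0) : Set ℕ) := by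
      intro a ha a' ha' h
      simp only [Finset.coe_filter, Set.mem_setOf_eq] at ha ha'
      have : f a = f a' := by
        have e1 : ((-f a).toNat : ℤ) = -f a := Int.toNat_of_nonneg (by linarith [ha.2])
        have e2 : ((-f a').toNat : ℤ) = -f a' := Int.toNat_of_nonneg (by linarith [ha'.2])
        have h' : ((-f a).toNat : ℤ) = ((-f a').toNat : ℤ) := by exact_mod_cast h
        rw [e1, e2] at h'; linarith
      exact hinj ha.1 ha'.1 this
    calc ∑ a ∈ S.filter (fun a => f a < 0), (Int.gcd (f a) Q : ℝ)
        = ∑ a ∈ S.filter (fun a => f a < 0), (Nat.gcd (-f a).toNat Q : ℝ) := by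
          refine Finset.sum_congr rfl fun a ha => ?_
          have ha' := (Finset.mem_filter.mp ha).2
          rw [Int.gcd_eq_natAbs, Int.natAbs_natCast]
          congr 2
          have : ((-f a).toNat : ℤ) = -f a := Int.toNat_of_nonneg (by linarith)
          omega
      _ = ∑ x ∈ (S.filter (fun a => f a < 0)).image (fun a => (-f a).toNat), (Nat.gcd x Q : ℝ) :=
          (Finset.sum_image (f := fun x => (Nat.gcd x Q : ℝ)) hinj').symm
      _ ≤ ∑ x ∈ Icc 1 N, (Nat.gcd x Q : ℝ) := by
          refine Finset.sum_le_sum_of_subset_of_nonneg ?_ fun _ _ _ => Nat.cast_nonneg _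
          intro x hx
          obtain ⟨a, ha, rfl⟩ := Finset.mem_image.mp hx
          have ha' := Finset.mem_filter.mp ha
          obtain ⟨hne, hle⟩ := hval a ha'.1
          rw [Finset.mem_Icc]
          constructor
          · have : 0 < (-f a).toNat := by omega
            exact this
          · have : ((-f a).toNat : ℤ) ≤ N := by
              rw [Int.toNat_of_nonneg (by linarith)]; exact (neg_le_abs _).trans hle
            exact_mod_cast this
      _ ≤ _ := BC_sum_gcd_Icc_le hQ N
  have hsplit : ∑ a ∈ S, (Int.gcd (f a) Q : ℝ) =
      ∑ a ∈ S.filter (fun a => 0 < f a), (Int.gcd (f a) Q : ℝ) +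
        ∑ a ∈ S.filter (fun a => f a < 0), (Int.gcd (f a) Q : ℝ) := by
    rw [← Finset.sum_filter_add_sum_filter_not S (fun a => 0 < f a)]
    congr 1
    refine Finset.sum_congr ?_ fun _ _ => rfl
    refine Finset.filter_congr fun a ha => ?_
    have := (hval a ha).1
    constructor
    · intro h; omega
    · intro h; omega
  rw [hsplit]
  linarith

/-- `#{ℓ ∈ S : ℓ ∣ w} ≤ τ(w)` for `w ≠ 0` (the condition `ℓ₂ ∣ ℓ₁n₁` of the diagonal). [folklore] -/
theorem BC_card_filter_dvd_le_card_divisors (S : Finset ℕ) {w : ℕ} (hw : w ≠ 0) :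
    (S.filter (fun ℓ => ℓ ∣ w)).card ≤ (Nat.divisors w).card := by
  refine Finset.card_le_card_of_injOn id (fun ℓ hℓ => ?_) (Set.injOn_id _)
  have h := (Finset.mem_filter.mp hℓ).2
  simpa [Nat.mem_divisors] using And.intro h hw

/-- `n₂` is determined by `ℓ₂ n₂ = w`: for `f ≥ 0` and `ℓ ≥ 1`,
`∑_{n ∈ T} [ℓ n = w] f(n) ≤ f(w / ℓ)`. [folklore] -/
theorem BC_sum_eq_mul_single_le (T : Finset ℕ) {ℓ : ℕ} (hℓ : 0 < ℓ) (w : ℕ) (f : ℕ → ℝ)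
    (hf : ∀ n, 0 ≤ f n) :
    ∑ n ∈ T, (if ℓ * n = w then f n else 0) ≤ f (w / ℓ) := by
  classical
  rw [← Finset.sum_filter]
  have hsub : T.filter (fun n => ℓ * n = w) ⊆ {w / ℓ} := by
    intro n hn
    have h := (Finset.mem_filter.mp hn).2
    rw [Finset.mem_singleton, ← h, Nat.mul_div_cancel_left _ hℓ]
  calc ∑ n ∈ T.filter (fun n => ℓ * n = w), f n ≤ ∑ n ∈ ({w / ℓ} : Finset ℕ), f n :=
        Finset.sum_le_sum_of_subset_of_nonneg hsub fun _ _ _ => hf _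
    _ = f (w / ℓ) := Finset.sum_singleton _ _

end Literature.NumberTheory.LFunctions

end
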